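import Literature.AlgebraicGeometry.Motives.MixedHodgeStructureUniserialRadicalSeries
import Literature.AlgebraicGeometry.Motives.MixedHodgeStructureIndecomposableDecomposition
import HarnessLib

/-!
# The number of summands of a decomposition versus the length; mixed Hodge structures of length two

Sequel to `MixedHodgeStructureLengthFormulas` (`λ(⊕ᵢ Sᵢ) = Σᵢ λ(Sᵢ)` for independent spanning sub-MHS),
`MixedHodgeStructureIndecomposableDecomposition` (decompositions into indecomposables; in a semisimple MHS the
indecomposable summands are simple) and `MixedHodgeStructureUniserial` (uniserial `⟺ λ = ℓℓ`, Krause Lemma 13.1.26).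
Lam, *A First Course in Noncommutative Rings*, Cor. (19.22): the number of summands of an indecomposable
decomposition is an invariant (the tree's `card_eq_of_decompositions`); Beachy §2.5: the length is additive. Here,
for mixed Hodge structures (Cattani–El Zein–Griffiths–Lê, Thm. 3.2.18):

* §1 **a decomposition `H = ⊕ᵢ Sᵢ` into non-zero sub-MHS has at most `λ(H)` summands**
  (`card_le_length_of_decomposition`), **with equality iff every summand is simple**
  (`card_eq_length_iff_forall_isSimple`); hence **`H` is semisimple iff some (equivalently: every) decomposition into
  indecomposables has exactly `λ(H)` summands** (`isSemisimple_iff_card_eq_length`); the number of summands is also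
  `≤ dim_ℚ V`.
* §2 **mixed Hodge structures of length `2`**: `ℓℓ(H) ∈ {1, 2}`; **`H` is either semisimple (`≅ S₁ ⊕ S₂`) or uniserial
  (a non-split extension of two simples), and not both** (`isSemisimple_or_isUniserial_of_length_eq_two`,
  `not_isSemisimple_and_isUniserial_of_length_eq_two`); `H` is uniserial iff indecomposable iff `ℓℓ(H) = 2`.

All statements proved; no definitions, no named facts, no instances.

## References

* [Lam2001FirstCourse] T. Y. Lam, A First Course in Noncommutative Rings, 2nd ed. (2001), Thm. (19.21), Cor. (19.22).
* [Beachy1999RingsModules] J. A. Beachy, Introductory Lectures on Rings and Modules (1999), §2.5, remark after Def. 2.5.3.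
* [Krause2021] H. Krause, Homological Theory of Representations (2021), Lemma 13.1.26.
* [CattaniElZeinGriffithsLe2014] E. Cattani et al. (eds.), Hodge Theory (2014), Thm. 3.2.18, p. 270.
-/

noncomputable section

namespace Literature.AlgebraicGeometry.Motives

namespace MixedHodgeStructure

open Module SubMixedHodgeStructure

universe u

variable {V : Type u} [AddCommGroup V] [Module ℚ V] [FiniteDimensional ℚ V] {H : MixedHodgeStructure V}

/-! ### §1 Number of summands versus length -/

section Decomposition

variable {ι : Type*} [Fintype ι] (S : ι → SubMixedHodgeStructure H)
  (hS : iSupIndep fun i => (S i).toSubmodule) (htop : ⨆ i, (S i).toSubmodule = ⊤)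
include hS htop

/-- **A decomposition `H = ⊕ᵢ Sᵢ` into non-zero sub-MHS has at most `λ(H)` summands.**
[cite: Beachy1999RingsModules, §2.5, remark after Def. 2.5.3] [cite: Lam2001FirstCourse, Cor. (19.22)] -/
theorem card_le_length_of_decomposition (hne : ∀ i, (S i).toSubmodule ≠ ⊥) : Fintype.card ι ≤ H.length := by
  rw [length_eq_sum_of_iSupIndep_of_iSup_eq_top S hS htop, ← Finset.card_univ, Finset.card_eq_sum_ones]
  refine Finset.sum_le_sum fun i _ => ?_
  haveI : Nontrivial (S i).toSubmodule := Submodule.nontrivial_iff_ne_bot.2 (hne i)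
  exact length_pos_iff.2 inferInstance

/-- **Equality `#summands = λ(H)` holds iff every summand is simple.** [cite: Beachy1999RingsModules, §2.5, remark after Def. 2.5.3]
[cite: CattaniElZeinGriffithsLe2014, p. 270] -/
theorem card_eq_length_iff_forall_isSimple (hne : ∀ i, (S i).toSubmodule ≠ ⊥) :
    Fintype.card ι = H.length ↔ ∀ i, (S i).toMixedHodgeStructure.IsSimple := by
  have hpos : ∀ i ∈ (Finset.univ : Finset ι), 1 ≤ (S i).toMixedHodgeStructure.length := fun i _ => by
    haveI : Nontrivial (S i).toSubmodule := Submodule.nontrivial_iff_ne_bot.2 (hne i)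
    exact length_pos_iff.2 inferInstance
  rw [length_eq_sum_of_iSupIndep_of_iSup_eq_top S hS htop, ← Finset.card_univ, Finset.card_eq_sum_ones,
    Finset.sum_eq_sum_iff_of_le hpos]
  exact ⟨fun h i => length_eq_one_iff.1 (h i (Finset.mem_univ i)).symm,
    fun h i _ => (length_eq_one_iff.2 (h i)).symm⟩

/-- A decomposition with `λ(H)` non-zero summands makes `H` semisimple. [cite: CattaniElZeinGriffithsLe2014, p. 270] -/
theorem isSemisimple_of_card_eq_length (hne : ∀ i, (S i).toSubmodule ≠ ⊥) (h : Fintype.card ι = H.length) :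
    H.IsSemisimple := by
  have hsimple := (card_eq_length_iff_forall_isSimple S hS htop hne).1 h
  refine isSemisimple_of_biSup_finset_eq_top S Finset.univ (fun i _ => (hsimple i).isSemisimple) ?_
  simp only [Finset.mem_univ, iSup_pos]
  exact htop

/-- **`H` is semisimple iff a decomposition into indecomposables has exactly `λ(H)` summands** (the summands of a
semisimple MHS are simple; conversely `λ(H)` summands force all summands to be simple).
[cite: Lam2001FirstCourse, Cor. (19.22)] [cite: CattaniElZeinGriffithsLe2014, p. 270] -/
theorem isSemisimple_iff_card_eq_length (hind : ∀ i, (S i).toMixedHodgeStructure.IsIndecomposable) :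
    H.IsSemisimple ↔ Fintype.card ι = H.length := by
  have hne : ∀ i, (S i).toSubmodule ≠ ⊥ := fun i =>
    Submodule.nontrivial_iff_ne_bot.1 (hind i).nontrivial
  refine ⟨fun h => (card_eq_length_iff_forall_isSimple S hS htop hne).2 fun i =>
    h.isSimple_of_isIndecomposable_summand (S i) (hind i), isSemisimple_of_card_eq_length S hS htop hne⟩

/-- For a non-semisimple `H`, every decomposition into indecomposables has fewer than `λ(H)` summands.
[cite: Lam2001FirstCourse, Cor. (19.22)] [cite: CattaniElZeinGriffithsLe2014, p. 270] -/
theorem card_lt_length_of_not_isSemisimple (hind : ∀ i, (S i).toMixedHodgeStructure.IsIndecomposable)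
    (h : ¬H.IsSemisimple) : Fintype.card ι < H.length :=
  lt_of_le_of_ne (card_le_length_of_decomposition S hS htop fun i =>
    Submodule.nontrivial_iff_ne_bot.1 (hind i).nontrivial) fun he => h ((isSemisimple_iff_card_eq_length S hS htop hind).2 he)

/-- The number of non-zero summands is at most `dim_ℚ V`. [cite: Lam2001FirstCourse, Cor. (19.22)] -/
theorem card_le_finrank_of_decomposition (hne : ∀ i, (S i).toSubmodule ≠ ⊥) : Fintype.card ι ≤ finrank ℚ V :=
  (card_le_length_of_decomposition S hS htop hne).trans (length_le_finrank H)

end Decomposition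

/-- **`H` is semisimple iff it has a decomposition into indecomposables with `λ(H)` summands** (using the
existence of indecomposable decompositions). [cite: Lam2001FirstCourse, Cor. (19.22)] [cite: CattaniElZeinGriffithsLe2014, p. 270] -/
theorem isSemisimple_iff_exists_decomposition_card_eq_length :
    H.IsSemisimple ↔ ∃ (n : ℕ) (S : Fin n → SubMixedHodgeStructure H), iSupIndep (fun i => (S i).toSubmodule) ∧
      (⨆ i, (S i).toSubmodule) = ⊤ ∧ (∀ i, (S i).toMixedHodgeStructure.IsIndecomposable) ∧ n = H.length := by
  obtain ⟨n, S, hS, htop, hind⟩ := exists_iSupIndep_isIndecomposable H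
  constructor
  · intro h
    refine ⟨n, S, hS, htop, hind, ?_⟩
    have e := (isSemisimple_iff_card_eq_length S hS htop hind).1 h
    rwa [Fintype.card_fin] at e
  · rintro ⟨m, T, hT, hTtop, hTind, hm⟩
    refine (isSemisimple_iff_card_eq_length T hT hTtop hTind).2 ?_
    rw [Fintype.card_fin, hm]

/-! ### §2 Mixed Hodge structures of length two -/

/-- `ℓℓ(H) ∈ {1, 2}` when `λ(H) = 2`. [cite: Krause2021, Lemma 13.1.26] [cite: CattaniElZeinGriffithsLe2014, p. 270] -/
theorem loewyLength_eq_one_or_two_of_length_eq_two (h : H.length = 2) : loewyLength H = 1 ∨ loewyLength H = 2 := by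
  have h1 := loewyLength_le_length H
  have h2 : 0 < loewyLength H := by
    rw [loewyLength_pos_iff, ← length_pos_iff (H := H)]
    omega
  omega

/-- **A mixed Hodge structure of length `2` is semisimple or uniserial** (`ℓℓ = 1`: semisimple, `≅ S₁ ⊕ S₂`;
`ℓℓ = 2 = λ`: uniserial, a non-split extension of two simple MHS). [cite: Krause2021, Lemma 13.1.26]
[cite: CattaniElZeinGriffithsLe2014, p. 270] -/
theorem isSemisimple_or_isUniserial_of_length_eq_two (h : H.length = 2) : H.IsSemisimple ∨ H.IsUniserial := by
  rcases loewyLength_eq_one_or_two_of_length_eq_two h with h1 | h2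
  · exact Or.inl (loewyLength_le_one_iff.1 h1.le)
  · exact Or.inr (isUniserial_iff_length_eq_loewyLength.2 (h.trans h2.symm))

/-- … and not both (a semisimple uniserial MHS is simple, of length `1`). [cite: Krause2021, Lemma 13.1.26] -/
theorem not_isSemisimple_and_isUniserial_of_length_eq_two (h : H.length = 2) : ¬(H.IsSemisimple ∧ H.IsUniserial) := by
  rintro ⟨hs, hu⟩
  haveI : Nontrivial V := (length_pos_iff (H := H)).1 (by omega)
  have h1 := length_eq_one_iff.2 (hu.isSimple_of_isSemisimple hs)
  omega

/-- For `λ(H) = 2`: **`H` is uniserial iff it is not semisimple.** [cite: Krause2021, Lemma 13.1.26] -/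
theorem isUniserial_iff_not_isSemisimple_of_length_eq_two (h : H.length = 2) : H.IsUniserial ↔ ¬H.IsSemisimple :=
  ⟨fun hu hs => not_isSemisimple_and_isUniserial_of_length_eq_two h ⟨hs, hu⟩,
    fun hs => (isSemisimple_or_isUniserial_of_length_eq_two h).resolve_left hs⟩

/-- For `λ(H) = 2`: `H` is uniserial iff `ℓℓ(H) = 2`, semisimple iff `ℓℓ(H) = 1`. [cite: Krause2021, Lemma 13.1.26] -/
theorem isUniserial_iff_loewyLength_eq_two_of_length_eq_two (h : H.length = 2) : H.IsUniserial ↔ loewyLength H = 2 := by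
  rw [isUniserial_iff_length_eq_loewyLength, h, eq_comm]

/-- For `λ(H) = 2`: `H` is semisimple iff `ℓℓ(H) = 1`. [cite: Krause2021, Lemma 13.1.26] [cite: CattaniElZeinGriffithsLe2014, p. 270] -/
theorem isSemisimple_iff_loewyLength_eq_one_of_length_eq_two (h : H.length = 2) : H.IsSemisimple ↔ loewyLength H = 1 := by
  rw [← loewyLength_le_one_iff]
  have := loewyLength_eq_one_or_two_of_length_eq_two h
  omega

/-- For `λ(H) = 2`: **`H` is uniserial iff it is indecomposable** (a decomposition of a length-`2` MHS into two
non-zero summands has simple summands). [cite: Krause2021, Lemma 13.1.26] [cite: Lam2001FirstCourse, Cor. (19.22)] -/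
theorem isUniserial_iff_isIndecomposable_of_length_eq_two (h : H.length = 2) : H.IsUniserial ↔ H.IsIndecomposable := by
  haveI : Nontrivial V := (length_pos_iff (H := H)).1 (by omega)
  refine ⟨fun hu => hu.isIndecomposable, fun hind => ?_⟩
  rw [isUniserial_iff_not_isSemisimple_of_length_eq_two h]
  intro hs
  have h1 := length_eq_one_iff.2 (hind.isSimple_of_isSemisimple hs)
  omega

end MixedHodgeStructure

end Literature.AlgebraicGeometry.Motives
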